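import Summits.Schanuel.Schanuel.Theorems.ZilberEacPunctureDensity
import Summits.Schanuel.Schanuel.Theorems.ZilberEacComplexOscillatoryBase
import HarnessLib

/-!
# Puncture-regime density with POLYNOMIAL moving targets: every `polyFibredGraph g A F` over a
# graph hypersurface with a negative ray has Zariski dense exponential points

Zilber's Exponential-Algebraic Closedness, case ladder (host summit Schanuel, cell `pub-schanuel`,
seat 2, gen 9).  `ZilberEacPunctureDensity` treated the affine decoupled targets `aⱼxⱼ + bⱼ`
(`fibredGraph`).  Here the targets are arbitrary nonzero polynomials `Aⱼ ∈ ℂ[x₀..x_s]` and the fibre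
polynomials `Fⱼ ∈ ℂ[u, x₀..x_s]` arbitrary:

  `W(g; A, F) = {x_{s+1} = g(x), yⱼ = Aⱼ(x) + y_{s+1} Fⱼ(y_{s+1}, x)} ⊆ ℂ^{s+2} × ℂ^{s+2}`
  (`polyFibredGraph g A F`), exponential points = solutions of
  `e^{xⱼ} = Aⱼ(x) + e^{g(x)} Fⱼ(e^{g(x)}, x)`.

**THEOREM (`unprojectedDense_polyFibredGraph_puncture`).**  `deg g ≥ 1`, a lattice direction `q₀`
(all `q₀ⱼ ≠ 0`) with `Re g_D(2πi q₀) < 0`, all `Aⱼ ≠ 0` ⟹ `I(W ∩ Γ_exp) = I(W)`.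
Existence along every admissible ray is gen 2's `exists_expPoint_of_re_leadingForm_neg`
(`ZilberEacComplexOscillatoryBase`); the density is THEOREM J′
(`unprojectedDense_of_directional_decay`) exactly as in `ZilberEacPunctureDensity`.
With `A` dominant and `deg g ≥ 2` these are certified members of `EC(s+2, s+1)`
(`polyFibredGraph_puncture_member_dense`); example in `EC(3,2)`:
`{x₂ = x₀² - x₁², y₀ = x₀ + y₂ x₁, y₁ = x₁ + y₂²}` (`e^z = z + w e^{z²-w²}`, `e^w = w + e^{2(z²-w²)}`).

HONEST FRAMING: explicit families inside an OPEN cell; existence was gen 2, NEW is the Zariski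
density; `EC(3,2)` OPEN; NOT Schanuel's conjecture; EAC ⇏ SC.
-/

noncomputable section

open Complex MvPolynomial Filter Topology
open Literature.NumberTheory.Transcendental Literature.ModelTheory.Zilber
  Literature.ModelTheory.ExponentialFields

set_option linter.dupNamespace false

namespace Summit.Schanuel.Schanuel.Theorems

section Poly

variable {s : ℕ}

/-- The exponential point of `W(g; A, F)` over a solution `x`. [folklore] -/
theorem pgParam_mem_expGraph_of_solution (g : MvPolynomial (Fin (s + 1)) ℂ)
    (A : Fin (s + 1) → MvPolynomial (Fin (s + 1)) ℂ) (F : Fin (s + 1) → MvPolynomial (Fin (s + 2)) ℂ)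
    {x : Fin (s + 1) → ℂ}
    (hx : ∀ j, exp (x j) = eval x (A j) + exp (eval x g) * eval (Fin.cons (exp (eval x g)) x) (F j)) :
    pgParam g A F x (exp (eval x g)) ∈ expGraph ℂ (s + 2) := by
  rw [mem_expGraph_iff]
  intro i
  refine Fin.lastCases ?_ (fun j => ?_) i
  · rw [pgParam_inl_last, pgParam_inr, pMulParam_last, ExponentialRing.complex_exp_eq]
  · rw [pgParam_inl_castSucc, pgParam_inr, pMulParam_castSucc, ExponentialRing.complex_exp_eq, hx j]

/-- **THEOREM (puncture-regime density, polynomial targets).**  See the module docstring. (new)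
[cite: MantovaMasser2023, §1 p.5 (the open case dim π(V) = 2 in ℂ³×ℂˣ³)] -/
theorem unprojectedDense_polyFibredGraph_puncture (g : MvPolynomial (Fin (s + 1)) ℂ)
    (hD : 0 < g.totalDegree) (q₀ : Fin (s + 1) → ℤ)
    (hq₀ : (eval (fun j => 2 * Real.pi * I * (q₀ j : ℂ))
      (homogeneousComponent g.totalDegree g)).re < 0)
    (hq₀0 : ∀ j, q₀ j ≠ 0) (A : Fin (s + 1) → MvPolynomial (Fin (s + 1)) ℂ) (hA0 : ∀ j, A j ≠ 0)
    (F : Fin (s + 1) → MvPolynomial (Fin (s + 2)) ℂ) :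
    UnprojectedDense (polyFibredGraph g A F) := by
  classical
  have hLhom : (homogeneousComponent g.totalDegree g).IsHomogeneous g.totalDegree :=
    homogeneousComponent_isHomogeneous _ _
  set LA : MvPolynomial (Fin (s + 1)) ℂ := ∏ j, homogeneousComponent (A j).totalDegree (A j) with hLA
  have hLA0 : LA ≠ 0 := Finset.prod_ne_zero_iff.2 fun j _ =>
    ExpDominant.homogeneousComponent_totalDegree_ne_zero (hA0 j)
  refine unprojectedDense_of_directional_decay (t := s + 1) (isIrreducibleClosed_polyFibredGraph g A F)
    (by rw [zariskiDim_polyFibredGraph]) (fun i => Sum.inl (Fin.castSucc i)) (Sum.inr (Fin.last (s + 1)))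
    (Q := {v : Fin (s + 1) → ℂ | ∃ q : Fin (s + 1) → ℤ, (v = fun i => 2 * Real.pi * I * (q i : ℂ)) ∧
      (eval (fun i => 2 * Real.pi * I * (q i : ℂ)) (homogeneousComponent g.totalDegree g)).re < 0 ∧
      eval (fun i => 2 * Real.pi * I * (q i : ℂ)) LA ≠ 0})
    (fun G hG => ?_) ?_
  · obtain ⟨q, hq, -, hGq⟩ := coneLatticeDirections_dense hLhom hq₀ hq₀0 (G * LA) (mul_ne_zero hG hLA0)
    rw [map_mul] at hGq
    exact ⟨_, ⟨q, rfl, hq, right_ne_zero_of_mul hGq⟩, left_ne_zero_of_mul hGq⟩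
  rintro v ⟨q, rfl, hq, hqA⟩
  have hA : ∀ j, eval (fun i => 2 * Real.pi * I * (q i : ℂ))
      (homogeneousComponent (A j).totalDegree (A j)) ≠ 0 := by
    rw [hLA, map_prod] at hqA
    exact fun j => (Finset.prod_ne_zero_iff.1 hqA) j (Finset.mem_univ j)
  -- existence along the ray, and a choice of solutions
  have hsol := exists_expPoint_of_re_leadingForm_neg g hD q hq A hA F
  set good : ℕ → (Fin (s + 1) → ℂ) → Prop := fun m x =>
    ‖x - fun i => (m : ℂ) * (2 * Real.pi * I * (q i : ℂ)) +
        log (eval (fun k => (m : ℂ) * (2 * Real.pi * I * (q k : ℂ))) (A i))‖ ≤ 1 / 2 ∧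
      ∀ j, exp (x j) = eval x (A j) + exp (eval x g) * eval (Fin.cons (exp (eval x g)) x) (F j)
    with hgood
  set xs : ℕ → Fin (s + 1) → ℂ := fun m => Classical.epsilon (good m) with hxs
  have hxs : ∀ᶠ m : ℕ in atTop, good m (xs m) := by
    filter_upwards [hsol] with m hm
    exact Classical.epsilon_spec hm
  set p : ℕ → Fin (s + 2) ⊕ Fin (s + 2) → ℂ := fun m =>
    pgParam g A F (xs m) (exp (eval (xs m) g)) with hp
  obtain ⟨K, hK0, hK⟩ := latticeCentre_control_of_leadingForm A _
    (fun i => re_two_pi_I_mul_int (q i)) hA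
  have hxv : ∀ᶠ m : ℕ in atTop,
      ‖xs m - fun i => (m : ℂ) * (2 * Real.pi * I * (q i : ℂ))‖ ≤ K * Real.log m := by
    filter_upwards [hxs, hK] with m hm hKm
    exact (hKm (xs m) hm.1).1
  refine ⟨p, ?_, ⟨K, ?_⟩, ?_, ?_⟩
  · filter_upwards [hxs] with m hm
    exact ⟨pgParam_mem g A F _ _, pgParam_mem_expGraph_of_solution g A F hm.2⟩
  · filter_upwards [hxv] with m hm
    have hcoord : (fun i => p m (Sum.inl (Fin.castSucc i))) = xs m := by
      funext i; simp [hp]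
    rw [hcoord]
    exact hm
  · filter_upwards with m
    simp only [hp, pgParam_inr, pMulParam_last]
    exact Complex.exp_ne_zero _
  · -- super-polynomial decay of `y_{s+1} = e^{g(x)}` (as in `unprojectedDense_fibredGraph_puncture`)
    set c₀ : ℝ := -(eval (fun i => 2 * Real.pi * I * (q i : ℂ))
      (homogeneousComponent g.totalDegree g)).re with hc₀
    have hc₀pos : 0 < c₀ := by rw [hc₀]; linarith
    obtain ⟨ρ, hρ, t₀, ht₀, hnear⟩ :=
      ExpDominant.eval_smul_near_top g (fun i => 2 * Real.pi * I * (q i : ℂ)) (half_pos hc₀pos)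
    have hρm := eventually_le_mul_of_le_log hxv ρ hρ
    have hbound : ∀ᶠ m : ℕ in atTop, c₀ / 2 * m ≤ -Real.log ‖p m (Sum.inr (Fin.last (s + 1)))‖ := by
      filter_upwards [hρm, tendsto_natCast_atTop_atTop.eventually_ge_atTop t₀,
        eventually_ge_atTop 1] with m hm hmt hm1
      have hm0r : (0 : ℝ) < m := by exact_mod_cast (show 0 < m by omega)
      simp only [hp, pgParam_inr, pMulParam_last, Complex.norm_exp, Real.log_exp]
      set ζ : Fin (s + 1) → ℂ := fun i =>
        (xs m i - (m : ℂ) * (2 * Real.pi * I * (q i : ℂ))) / (m : ℂ) with hζ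
      have hζnorm : ‖ζ‖ ≤ ρ := by
        refine (pi_norm_le_iff_of_nonneg hρ.le).2 fun i => ?_
        rw [hζ]
        dsimp only
        rw [norm_div, Complex.norm_natCast, div_le_iff₀ hm0r]
        exact (norm_le_pi_norm (xs m - fun i => (m : ℂ) * (2 * Real.pi * I * (q i : ℂ))) i).trans hm
      have hxζ : ((m : ℝ) : ℂ) • ((fun i => 2 * Real.pi * I * (q i : ℂ)) + ζ) = xs m := by
        funext i
        have hm0 : (m : ℂ) ≠ 0 := by exact_mod_cast (show m ≠ 0 by omega)
        simp only [Pi.smul_apply, Pi.add_apply, smul_eq_mul, hζ, Complex.ofReal_natCast]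
        field_simp
        ring
      have hn := hnear m hmt ζ hζnorm
      rw [hxζ] at hn
      have hre : (eval (xs m) g).re ≤ (((m : ℝ) : ℂ) ^ g.totalDegree *
          eval (fun i => 2 * Real.pi * I * (q i : ℂ)) (homogeneousComponent g.totalDegree g)).re +
          ‖eval (xs m) g - ((m : ℝ) : ℂ) ^ g.totalDegree *
            eval (fun i => 2 * Real.pi * I * (q i : ℂ)) (homogeneousComponent g.totalDegree g)‖ := by
        have h := Complex.re_le_norm (eval (xs m) g - ((m : ℝ) : ℂ) ^ g.totalDegree *
          eval (fun i => 2 * Real.pi * I * (q i : ℂ)) (homogeneousComponent g.totalDegree g))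
        rw [Complex.sub_re] at h
        linarith
      have hre2 : (((m : ℝ) : ℂ) ^ g.totalDegree * eval (fun i => 2 * Real.pi * I * (q i : ℂ))
          (homogeneousComponent g.totalDegree g)).re = -(c₀ * (m : ℝ) ^ g.totalDegree) := by
        rw [← Complex.ofReal_pow, Complex.re_ofReal_mul, hc₀]; ring
      have hpow : (m : ℝ) ≤ (m : ℝ) ^ g.totalDegree := by
        have := pow_le_pow_right₀ (by exact_mod_cast hm1 : (1 : ℝ) ≤ m) hD
        rwa [pow_one] at this
      nlinarith [hre, hre2, hn, hpow, hc₀pos]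
    refine tendsto_atTop_mono' atTop ?_
      ((tendsto_natCast_div_log_atTop).const_mul_atTop (half_pos hc₀pos))
    filter_upwards [hbound, eventually_gt_atTop 2] with m hm hm2
    have hlog : 0 < Real.log m := Real.log_pos (by exact_mod_cast (show 1 < m by omega))
    rw [mul_div_assoc', le_div_iff₀ hlog, div_mul_cancel₀ _ hlog.ne']
    exact hm

/-- **Certified members with dense exponential points.**  `A` dominant (`aeval A` injective),
`deg g ≥ 2`, a negative lattice direction: `polyFibredGraph g A F` satisfies all seven hypotheses of
`ECCell (s+2) (s+1)`, is not linearly split, AND `I(W ∩ Γ_exp) = I(W)`. (new)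
[cite: MantovaMasser2023, §1 p.5 (the open case dim π(V) = 2 in ℂ³×ℂˣ³)] -/
theorem polyFibredGraph_puncture_member_dense (g : MvPolynomial (Fin (s + 1)) ℂ)
    (hg : 2 ≤ g.totalDegree) (q₀ : Fin (s + 1) → ℤ)
    (hq₀ : (eval (fun j => 2 * Real.pi * I * (q₀ j : ℂ))
      (homogeneousComponent g.totalDegree g)).re < 0)
    (hq₀0 : ∀ j, q₀ j ≠ 0) (A : Fin (s + 1) → MvPolynomial (Fin (s + 1)) ℂ)
    (hA : Function.Injective (aeval A : MvPolynomial (Fin (s + 1)) ℂ →ₐ[ℂ] MvPolynomial (Fin (s + 1)) ℂ))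
    (F : Fin (s + 1) → MvPolynomial (Fin (s + 2)) ℂ) :
    (IsIrreducibleClosed ℂ (polyFibredGraph g A F) ∧
      (polyFibredGraph g A F ∩ torusLocus ℂ (s + 2)).Nonempty ∧
      IsRotund ℂ (s + 2) (polyFibredGraph g A F ∩ torusLocus ℂ (s + 2)) ∧
      IsAddFree ℂ (s + 2) (polyFibredGraph g A F ∩ torusLocus ℂ (s + 2)) ∧
      IsMulFree ℂ (s + 2) (polyFibredGraph g A F ∩ torusLocus ℂ (s + 2)) ∧
      zariskiDim ℂ (polyFibredGraph g A F) = (s + 2 : ℕ) ∧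
      addProjDim ℂ (s + 2) (polyFibredGraph g A F) = (s + 1 : ℕ)) ∧
    ¬ IsLinearSplit ℂ (s + 2) (polyFibredGraph g A F) ∧
    UnprojectedDense (polyFibredGraph g A F) := by
  have hA0 : ∀ j, A j ≠ 0 := by
    intro j hj
    have h1 : (aeval A : MvPolynomial (Fin (s + 1)) ℂ →ₐ[ℂ] MvPolynomial (Fin (s + 1)) ℂ) (X j) =
        (aeval A : MvPolynomial (Fin (s + 1)) ℂ →ₐ[ℂ] MvPolynomial (Fin (s + 1)) ℂ) 0 := by
      rw [aeval_X, hj, map_zero]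
    exact X_ne_zero j (hA h1)
  exact ⟨ecCell_hypotheses_polyFibredGraph g A F hA hg,
    not_isLinearSplit_polyFibredGraph g A F (Nat.succ_pos s) hA,
    unprojectedDense_polyFibredGraph_puncture g (by omega) q₀ hq₀ hq₀0 A hA0 F⟩

/-- **Example in `EC(3,2)` with `x`-dependent fibre polynomials**:
`{x₂ = x₀² - x₁², y₀ = x₀ + y₂ x₁, y₁ = x₁ + y₂²}` (`e^z = z + w e^{z²-w²}`,
`e^w = w + e^{2(z²-w²)}`): certified member, not linearly split, dense exponential points. (new)
[cite: MantovaMasser2023, §1 p.5 (the open case dim π(V) = 2 in ℂ³×ℂˣ³)] -/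
theorem xDependent_model_member_dense :
    (IsIrreducibleClosed ℂ (polyFibredGraph (X 0 ^ 2 - X 1 ^ 2 : MvPolynomial (Fin 2) ℂ)
        (fun j => X j) ![X 2, X 0]) ∧
      (polyFibredGraph (X 0 ^ 2 - X 1 ^ 2 : MvPolynomial (Fin 2) ℂ) (fun j => X j) ![X 2, X 0] ∩
        torusLocus ℂ 3).Nonempty ∧
      IsRotund ℂ 3 (polyFibredGraph (X 0 ^ 2 - X 1 ^ 2 : MvPolynomial (Fin 2) ℂ) (fun j => X j)
        ![X 2, X 0] ∩ torusLocus ℂ 3) ∧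
      IsAddFree ℂ 3 (polyFibredGraph (X 0 ^ 2 - X 1 ^ 2 : MvPolynomial (Fin 2) ℂ) (fun j => X j)
        ![X 2, X 0] ∩ torusLocus ℂ 3) ∧
      IsMulFree ℂ 3 (polyFibredGraph (X 0 ^ 2 - X 1 ^ 2 : MvPolynomial (Fin 2) ℂ) (fun j => X j)
        ![X 2, X 0] ∩ torusLocus ℂ 3) ∧
      zariskiDim ℂ (polyFibredGraph (X 0 ^ 2 - X 1 ^ 2 : MvPolynomial (Fin 2) ℂ) (fun j => X j)
        ![X 2, X 0]) = (3 : ℕ) ∧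
      addProjDim ℂ 3 (polyFibredGraph (X 0 ^ 2 - X 1 ^ 2 : MvPolynomial (Fin 2) ℂ) (fun j => X j)
        ![X 2, X 0]) = (2 : ℕ)) ∧
    ¬ IsLinearSplit ℂ 3 (polyFibredGraph (X 0 ^ 2 - X 1 ^ 2 : MvPolynomial (Fin 2) ℂ) (fun j => X j)
        ![X 2, X 0]) ∧
    UnprojectedDense (polyFibredGraph (X 0 ^ 2 - X 1 ^ 2 : MvPolynomial (Fin 2) ℂ) (fun j => X j)
        ![X 2, X 0]) := by
  obtain ⟨hdeg, hq⟩ := mantovaMasserModel_data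
  have hA : Function.Injective (aeval (fun j : Fin 2 => (X j : MvPolynomial (Fin 2) ℂ)) :
      MvPolynomial (Fin 2) ℂ →ₐ[ℂ] MvPolynomial (Fin 2) ℂ) := by
    rw [aeval_X_left]; exact fun _ _ h => h
  exact polyFibredGraph_puncture_member_dense _ (by rw [hdeg]) ![2, 1] hq
    (fun j => by fin_cases j <;> simp) _ hA _

end Poly

end Summit.Schanuel.Schanuel.Theorems

end
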